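import Summits.NavierStokesRegularity.NavierStokesRegularity.Theorems.CertifiedBlowupCertifiedBlowupVorticityRateBlowupConstantFloorSharp
import Literature.Analysis.FluidPDE.ConstantinDirectionDissipationProofs
import Literature.Analysis.FluidPDE.BKMClassGradientContinuity
import HarnessLib

/-!
# Certificate class `CertifiedBlowupVorticityRateBlowup` (stmt-NavierStokesRegularity-8639): THE DISSIPATION BUDGET —
# under `(T − t)‖ω(t)‖_∞ ≤ C` the ENSTROPHY IS TYPE I, `(T − t)∫|ω(t)|² ≤ e κ C E(u₀)/ν`, and the VELOCITY RATE IS AT MOST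
# `2/3`, `(T − t)²‖u(t, x)‖³ ≤ 8(4π)⁻¹ e κ C² E(u₀)/ν`, UNIFORMLY IN `t`, FOR EVERY CERTIFICATE CONSTANT `C`

Theorems file landed `--supports stmt-NavierStokesRegularity-8639` (cell `ns-blowup`, GROUP B zone Z1 → the certificate
crux; twelfth crux-side deposit of the zone-Z1 seat). Deposits 6–11 (`…ConstantFloor`, `…VelocityExponent`, `…SlabFloor`,
`…SlabExponent`, `…ConstantFloorSharp`) compared the enstrophy slab Grönwall `(S_κ)` with Leray's LOWER enstrophy rate
and obtained the floor `C > 1/(2κ)` and the `C`-dependent modulation law (enstrophy `≲ (T − t)^{−κC}`, velocity exponent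
`γ_u ≤ (1 + κC)/3`). This file adds the one a priori input those deposits do not use — the ENERGY DISSIPATION BUDGET of
the Leray–Hopf solution, `ν ∫₀ᵀ ∫|∇u|²_F ≤ E(u₀) = ½‖u₀‖₂²` (tree: `IsLerayHopfOn.lintegral_frobeniusNormSq_fderiv_of_classical`)
— and runs `(S_κ)` BACKWARDS on a window `[t₁, t₂]`: every earlier slice of the window carries at least the fraction
`exp(−κC(t₂ − t₁)/(T − t₂))` of the final enstrophy, while the window's time-integrated enstrophy is paid for by the
energy. With the window length `θ(T − t₂)`, `θ = 1/(κC)`, this caps the enstrophy at the TYPE-I rate and, through the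
Biot–Savart interpolation `‖u‖_∞ ≤ 2(4π)^{−1/3}‖ω‖_∞^{1/3}‖ω‖₂^{2/3}` of deposit 8, the velocity at the rate `(T − t)^{−2/3}`
— both UNIFORMLY in `t` and for EVERY certificate constant `C` (the slab hypothesis `(S_κ)` is the binder `hslab` of
deposit 9, discharged at `κ = 2` by `slab_gronwall_two` and at the strain value `κ = 2/√3` by `slab_gronwall_sharp`):

* `cube_norm_le_of_norm_curl_le` — SLICE BIOT–SAVART: `‖curl u(t)‖ ≤ Ω` everywhere ⇒ `‖u(t, x)‖³ ≤ 8(4π)⁻¹ Ω ∫|ω(t)|²`;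
* `lintegral_frobenius_eq_ofReal_integral_sq_norm_curl` — the `div`–`curl` identity on a slice, `∫|∇u(t)|²_F = ∫|ω(t)|²`;
* `lintegral_Ioo_enstrophy_le` — THE BUDGET READ ON THE VORTICITY: `∫_{t₁}^{t₂} ∫|ω(t)|² dt ≤ E(u₀)/ν` (`0 ≤ t₁ ≤ t₂ ≤ T`);
* `window_mul_integral_sq_norm_curl_le_of_slab` — THE WINDOW INEQUALITY: under `(S_κ)`, `κ ≥ 0`, and the rate on `[t₀, T)`,
  for `t₀ ≤ t₁ < t₂ < T`: `(t₂ − t₁) ∫|ω(t₂)|² ≤ (E(u₀)/ν) · exp(κC(t₂ − t₁)/(T − t₂))`;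
* `mul_integral_sq_norm_curl_le_of_slab` — **TYPE-I ENSTROPHY: `(T − t) ∫|ω(t)|² ≤ e κ C E(u₀)/ν`** for every `t ∈ [t₀, T)`
  late enough that the optimal window fits, `(T − t)/(κC) ≤ t − t₀` (`κ, C > 0`);
* `sq_mul_cube_norm_le_of_slab` — **VELOCITY CAP: `(T − t)² ‖u(t, x)‖³ ≤ 8(4π)⁻¹ e κ C² E(u₀)/ν`** at the same times, all `x`;
* `mul_gauge_vertex_distance_cube_le_of_slab` — GAUGE FORM: at such a time `tₖ` with `λₖ > 0` and a near-max point,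
  `(λₖ/ν)‖u(tₖ, xₖ)‖ ≥ 1/2`, the vertex distance `dₖ = ν(T − tₖ)/λₖ²` obeys `(T − tₖ) dₖ³ ≤ (64/ν³) B²`,
  `B = 8(4π)⁻¹ e κ C² E(u₀)/ν`: **`dₖ ≲ (T − tₖ)^{−1/3}` along EVERY near-max gauge sequence** (deposit 7's KNSS Type-II
  sequence has `dₖ → ∞`; this is its a priori speed limit);
* the witness forms (`∀ᶠ t → T⁻`) at the strain value `κ = 2/√3` and the certificate-free rider
  `liminf (T − t)‖∇u(t)‖₂² = 0` are in the companion file `…VorticityRateBlowupDissipationBudgetSharp` (400-line rule).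

ZONE-Z1 READING (TEMPLATE T1.2 modulation dictionary): a certificate-class witness with constant `C_ω` has ENSTROPHY
EXPONENT in `[1/2, min(κC_ω, 1)]` (Leray's floor `cν^{3/2}(T − t)^{−1/2}` below, deposit 10 and this file above) and
VELOCITY EXPONENT `γ_u ≤ min((1 + κC_ω)/3, 2/3)`; at `κ = 2/√3` the budget is the better bound exactly when `C_ω > √3/2`.
K-AUDIT HOOK: a candidate printing `‖u‖_∞ ∼ (T − t)^{−γ}` with `γ > 2/3` (Hou-type `γ = 1`) lies OUTSIDE the certificate
class for EVERY `C_ω`. The floor `√3/4` does not move (the budget is compared with an integrable rate). No new definitions,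
no named-fact hypotheses, no `sorry`. WHAT THIS IS NOT: not a blow-up or regularity claim — a priori inequalities about a
HYPOTHETICAL witness of the certificate class; crux 8639, crux 8640 and (AX-L) are untouched. Author:
ns-blowup-profile-eng-1 g13, 2026-08-27.

## References
* J. Leray, Acta Math. 63 (1934), §17 (3.4) (energy equality), §20 (3.12). [Leray1934]
* P. Constantin, Comm. Math. Phys. 129 (1990), §2 (2.21) (the dissipation budget of Leray–Hopf solutions). [Constantin1990]
* J. C. Robinson, J. L. Rodrigo, W. Sadowski, CUP 2016, Thm 12.3 (12.11)–(12.12). [RobinsonRodrigoSadowski2016]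
* A. J. Majda, A. L. Bertozzi, CUP 2002, §2.4.1 Prop. 2.16, §4.1.3 (4.30). [MajdaBertozziCUP2002]
* G. Koch, N. Nadirashvili, G. Seregin, V. Šverák, Acta Math. 203 (2009), Thms 6.1–6.2. [KochNadirashviliSereginSverak2009]
-/

-- the summit and its single problem share the name (D-0017 nested layout)
set_option linter.dupNamespace false

noncomputable section

open MeasureTheory Set Function Filter Topology Metric
open scoped ENNReal NNReal

namespace Summit.NavierStokesRegularity.NavierStokesRegularity.Theorems.CertifiedBlowupVorticityRateBlowup.DissipationBudget

open Literature.Analysis.FluidPDE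
open Summit.NavierStokesRegularity.NavierStokesRegularity.Theorems.CertifiedBlowupAxisymBlowup.CompactAmplification
open Summit.NavierStokesRegularity.NavierStokesRegularity.Theorems.CertifiedBlowupVorticityRateBlowup.ConstantFloor
open Summit.NavierStokesRegularity.NavierStokesRegularity.Theorems.CertifiedBlowupVorticityRateBlowup.SlabFloor

variable {ν T : ℝ} {u : ℝ → EuclideanSpace ℝ (Fin 3) → EuclideanSpace ℝ (Fin 3)}
  {p : ℝ → EuclideanSpace ℝ (Fin 3) → ℝ}

/-! ### Slice tools: Biot–Savart and the `div`–`curl` identity -/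

/-- Slice data in the Beale–Kato–Majda class: for a classical solution on `[0, T) × ℝ³` with all `L²` Sobolev norms bounded
on every earlier closed slab and `t ∈ [0, T)`, the slice `u(t)` has `u(t), D¹u(t), D²u(t), curl u(t) ∈ L²` and
`|curl u(t)|²` integrable. [folklore] -/
theorem slice_sq_integrable (hcl : IsClassicalNSSolutionOn (Ico 0 T) ν 0 u p)
    (hreg : ∀ T'' < T, HasBoundedSobolevNormsOn (Icc 0 T'') u) {t : ℝ} (ht : t ∈ Ico 0 T) :
    (∫⁻ y, ‖u t y‖ₑ ^ 2 < ⊤) ∧ (∫⁻ y, ‖iteratedFDeriv ℝ 1 (u t) y‖ₑ ^ 2 < ⊤) ∧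
      (∫⁻ y, ‖iteratedFDeriv ℝ 2 (u t) y‖ₑ ^ 2 < ⊤) ∧ (∫⁻ y, ‖curl (u t) y‖ₑ ^ 2 < ⊤) ∧
      Integrable (fun y => ‖curl (u t) y‖ ^ 2) := by
  set T'' : ℝ := (t + T) / 2 with hT''
  have hT''T : T'' < T := by rw [hT'']; linarith [ht.2]
  have hB : HasBoundedSobolevNormsOn (Icc 0 T'') u := hreg T'' hT''T
  have htS : t ∈ Icc 0 T'' := ⟨ht.1, by rw [hT'']; linarith [ht.2]⟩
  have hvt := hcl.contDiff_velocity ht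
  have h0 : ∫⁻ y, ‖u t y‖ₑ ^ 2 < ⊤ := by
    obtain ⟨C0, hC0⟩ := hB 0
    refine lt_of_le_of_lt (le_of_eq (lintegral_congr fun y => ?_)) ((hC0 t htS).trans_lt ENNReal.coe_lt_top)
    rw [← ofReal_norm, ← ofReal_norm, norm_iteratedFDeriv_zero]
  have h1 : ∫⁻ y, ‖iteratedFDeriv ℝ 1 (u t) y‖ₑ ^ 2 < ⊤ := by
    obtain ⟨C1, hC1⟩ := hB 1
    exact (hC1 t htS).trans_lt ENNReal.coe_lt_top
  have h2 : ∫⁻ y, ‖iteratedFDeriv ℝ 2 (u t) y‖ₑ ^ 2 < ⊤ := by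
    obtain ⟨C2, hC2⟩ := hB 2
    exact (hC2 t htS).trans_lt ENNReal.coe_lt_top
  have hω2 : ∫⁻ y, ‖curl (u t) y‖ₑ ^ 2 < ⊤ :=
    lt_of_le_of_lt (lintegral_curl_sq_le (u t)) (ENNReal.mul_lt_top ENNReal.ofReal_lt_top h1)
  have hωc : Continuous (curl (u t)) := continuous_curl (hvt.of_le (by norm_cast))
  exact ⟨h0, h1, h2, hω2, integrable_sq_norm_of_lintegral_lt_top hωc hω2⟩

/-- **Slice Biot–Savart.** For a classical solution on `[0, T) × ℝ³` in the Beale–Kato–Majda class on earlier slabs,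
`t ∈ [0, T)`, and `Ω` with `‖curl u(t, y)‖ ≤ Ω` for all `y`: `‖u(t, x)‖³ ≤ 8(4π)⁻¹ Ω ∫|curl u(t)|²` for every `x` — the
slice is the Biot–Savart velocity of its vorticity (`biotSavart_curl_eq_self_of_lintegral_sq_lt_top`) and
`‖K₃ ∗ ω‖_∞ ≤ 2(4π)^{−1/3}‖ω‖_∞^{1/3}‖ω‖₂^{2/3}` (`norm_biotSavart_le_rpow_third`), cubed.
[cite: MajdaBertozziCUP2002, §2.4.1 Prop. 2.16 and §4.1.3 (4.30)] -/
theorem cube_norm_le_of_norm_curl_le (hcl : IsClassicalNSSolutionOn (Ico 0 T) ν 0 u p)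
    (hreg : ∀ T'' < T, HasBoundedSobolevNormsOn (Icc 0 T'') u) {t : ℝ} (ht : t ∈ Ico 0 T) {Ω : ℝ}
    (hΩ : ∀ y, ‖curl (u t) y‖ ≤ Ω) (x : EuclideanSpace ℝ (Fin 3)) :
    ‖u t x‖ ^ 3 ≤ 8 * (4 * Real.pi)⁻¹ * Ω * ∫ y, ‖curl (u t) y‖ ^ 2 := by
  obtain ⟨hv2, -, -, hω2, hωI⟩ := slice_sq_integrable hcl hreg ht
  have hvt := hcl.contDiff_velocity ht
  have hωc : Continuous (curl (u t)) := continuous_curl (hvt.of_le (by norm_cast))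
  have hrep : biotSavart (curl (u t)) = u t :=
    biotSavart_curl_eq_self_of_lintegral_sq_lt_top (hvt.of_le (by norm_cast)) (hcl.divFree t ht) hv2 hω2
  have hΩ0 : 0 ≤ Ω := (norm_nonneg _).trans (hΩ 0)
  set E : ℝ := ∫ y, ‖curl (u t) y‖ ^ 2 with hE
  have hE0 : 0 ≤ E := integral_nonneg fun y => sq_nonneg _
  have hbs := norm_biotSavart_le_rpow_third hωc.aestronglyMeasurable hΩ hωI x
  rw [hrep] at hbs
  have hpi : 0 < (4 * Real.pi)⁻¹ := by positivity
  have h3 := pow_le_pow_left₀ (norm_nonneg _) hbs 3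
  refine h3.trans (le_of_eq ?_)
  have hc : ∀ a : ℝ, 0 ≤ a → (a ^ (1 / 3 : ℝ)) ^ 3 = a := fun a ha => by
    rw [← Real.rpow_natCast, ← Real.rpow_mul ha]; norm_num
  calc (2 * ((4 * Real.pi)⁻¹) ^ (1 / 3 : ℝ) * Ω ^ (1 / 3 : ℝ) * E ^ (1 / 3 : ℝ)) ^ 3
      = 8 * ((4 * Real.pi)⁻¹ ^ (1 / 3 : ℝ)) ^ 3 * (Ω ^ (1 / 3 : ℝ)) ^ 3 * (E ^ (1 / 3 : ℝ)) ^ 3 := by ring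
    _ = 8 * (4 * Real.pi)⁻¹ * Ω * E := by rw [hc _ hpi.le, hc _ hΩ0, hc _ hE0]

/-- **The `div`–`curl` identity on a slice.** For a classical solution on `[0, T) × ℝ³` in the Beale–Kato–Majda class on
earlier slabs and `t ∈ [0, T)`: `∫|∇u(t)|²_F = ∫|curl u(t)|²` (as an identity of extended reals, the right-hand side a
Bochner integral) — the tree's `lintegral_frobeniusNormSq_fderiv_eq_lintegral_curl_sq` for divergence-free `H²` fields.
[cite: MajdaBertozziCUP2002, §2.4.1 Prop. 2.16] -/
theorem lintegral_frobenius_eq_ofReal_integral_sq_norm_curl (hcl : IsClassicalNSSolutionOn (Ico 0 T) ν 0 u p)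
    (hreg : ∀ T'' < T, HasBoundedSobolevNormsOn (Icc 0 T'') u) {t : ℝ} (ht : t ∈ Ico 0 T) :
    ∫⁻ x, ENNReal.ofReal (frobeniusNormSq (fderiv ℝ (u t) x)) = ENNReal.ofReal (∫ x, ‖curl (u t) x‖ ^ 2) := by
  obtain ⟨hv2, h1, h2, -, hωI⟩ := slice_sq_integrable hcl hreg ht
  have hvt := hcl.contDiff_velocity ht
  rw [lintegral_frobeniusNormSq_fderiv_eq_lintegral_curl_sq (hvt.of_le (by norm_cast)) (hcl.divFree t ht) hv2 h1 h2,
    show (∫⁻ x, ‖curl (u t) x‖ₑ ^ 2) = ∫⁻ x, ENNReal.ofReal (‖curl (u t) x‖ ^ 2) from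
      lintegral_congr fun x => by rw [← ofReal_norm, ENNReal.ofReal_pow (norm_nonneg _)],
    ← ofReal_integral_eq_lintegral_ofReal hωI (Eventually.of_forall fun x => sq_nonneg _)]

/-! ### The dissipation budget read on the vorticity -/

/-- **The budget.** For a classical Leray–Hopf solution on `[0, T) × ℝ³`, `ν > 0`, from a rapidly decaying datum and
`0 ≤ t₁ ≤ t₂ ≤ T`: `∫_{t₁}^{t₂} (∫|curl u(t)|²) dt ≤ E(u₀)/ν`, `E(u₀) = ½‖u(0)‖₂²` (stated with the lower Lebesgue
integral in time, so that no time-measurability is needed downstream) — the Leray–Hopf energy inequality through the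
classical gradient, `ν ∫₀ᵀ∫|∇u|²_F ≤ E(u₀)` (`IsLerayHopfOn.lintegral_frobeniusNormSq_fderiv_of_classical`), and the
slice identity `∫|∇u(t)|²_F = ∫|ω(t)|²`. [cite: Constantin1990, §2 eq. (2.21); Leray1934, §17 (3.4)] -/
theorem lintegral_Ioo_enstrophy_le (hν : 0 < ν) (hT : 0 < T) (hcl : IsClassicalNSSolutionOn (Ico 0 T) ν 0 u p)
    (hLH : IsLerayHopfOn T ν 0 (u 0) u) (hdec : HasRapidSpatialDecay (u 0)) {t₁ t₂ : ℝ} (ht₁ : 0 ≤ t₁)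
    (ht₂ : t₂ ≤ T) :
    ∫⁻ t in Ioo t₁ t₂, ENNReal.ofReal (∫ x, ‖curl (u t) x‖ ^ 2) ≤
      ENNReal.ofReal (VectorCalculus.kineticEnergy (u 0) / ν) := by
  have hreg := hasBoundedSobolevNormsOn_before_of_lerayHopf_classical hν hT hcl hLH hdec
  obtain ⟨hfin, hbud⟩ := hLH.lintegral_frobeniusNormSq_fderiv_of_classical hcl hT
  set D : ℝ≥0∞ := ∫⁻ τ in Ioo 0 T, ∫⁻ x, ENNReal.ofReal (frobeniusNormSq (fderiv ℝ (u τ) x)) with hD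
  have hsub : Ioo t₁ t₂ ⊆ Ioo 0 T := Ioo_subset_Ioo ht₁ ht₂
  calc ∫⁻ t in Ioo t₁ t₂, ENNReal.ofReal (∫ x, ‖curl (u t) x‖ ^ 2)
      ≤ ∫⁻ t in Ioo 0 T, ENNReal.ofReal (∫ x, ‖curl (u t) x‖ ^ 2) := lintegral_mono_set hsub
    _ = D := by
        rw [hD]
        refine setLIntegral_congr_fun measurableSet_Ioo fun t ht => ?_
        exact (lintegral_frobenius_eq_ofReal_integral_sq_norm_curl hcl hreg ⟨ht.1.le, ht.2⟩).symm
    _ = ENNReal.ofReal D.toReal := (ENNReal.ofReal_toReal hfin).symm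
    _ ≤ ENNReal.ofReal (VectorCalculus.kineticEnergy (u 0) / ν) := by
        refine ENNReal.ofReal_le_ofReal ?_
        rw [le_div_iff₀ hν, mul_comm]
        exact hbud

/-! ### The window inequality and the Type-I enstrophy cap -/

/-- **The window inequality.** Let `(u, p)` be a classical Leray–Hopf solution on `[0, T) × ℝ³`, `ν > 0`, from a rapidly
decaying datum, satisfying the slab Grönwall `(S_κ)` with `κ ≥ 0` and the rate `(T − t)‖curl u(t, x)‖ ≤ C` on `[t₀, T)`
(`t₀ ≥ 0`). Then for `t₀ ≤ t₁ < t₂ < T`: `(t₂ − t₁) ∫|ω(t₂)|² ≤ (E(u₀)/ν) · exp(κC(t₂ − t₁)/(T − t₂))`. Indeed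
`|ω| ≤ C/(T − t₂)` on `[t₁, t₂]`, so `(S_κ)` on `[t, t₂]` gives `∫|ω(t)|² ≥ ∫|ω(t₂)|² · exp(−κC(t₂ − t₁)/(T − t₂))` for every
`t ∈ (t₁, t₂)`, and the time integral of the left-hand side is at most `E(u₀)/ν`. [new here — elementary] -/
theorem window_mul_integral_sq_norm_curl_le_of_slab (hν : 0 < ν) (hT : 0 < T)
    (hcl : IsClassicalNSSolutionOn (Ico 0 T) ν 0 u p) (hLH : IsLerayHopfOn T ν 0 (u 0) u)
    (hdec : HasRapidSpatialDecay (u 0)) {κ : ℝ} (hκ : 0 ≤ κ)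
    (hslab : ∀ ⦃t₁ t₂ Ω : ℝ⦄, 0 ≤ t₁ → t₁ < t₂ → t₂ < T → (∀ t ∈ Icc t₁ t₂, ∀ x, ‖curl (u t) x‖ ≤ Ω) →
      ∫ x, ‖curl (u t₂) x‖ ^ 2 ≤ (∫ x, ‖curl (u t₁) x‖ ^ 2) * Real.exp (κ * Ω * (t₂ - t₁)))
    {C t₀ : ℝ} (ht₀ : 0 ≤ t₀) (hω : ∀ t ∈ Ico t₀ T, ∀ x, (T - t) * ‖curl (u t) x‖ ≤ C)
    {t₁ t₂ : ℝ} (h01 : t₀ ≤ t₁) (h12 : t₁ < t₂) (h2T : t₂ < T) :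
    (t₂ - t₁) * ∫ x, ‖curl (u t₂) x‖ ^ 2 ≤
      VectorCalculus.kineticEnergy (u 0) / ν * Real.exp (κ * C * (t₂ - t₁) / (T - t₂)) := by
  have hTt₂ : 0 < T - t₂ := sub_pos.2 h2T
  have ht₁0 : 0 ≤ t₁ := ht₀.trans h01
  have hC0 : 0 ≤ C :=
    le_trans (mul_nonneg hTt₂.le (norm_nonneg _)) (hω t₂ ⟨h01.trans h12.le, h2T⟩ 0)
  set E₂ : ℝ := ∫ x, ‖curl (u t₂) x‖ ^ 2 with hE₂
  have hE₂0 : 0 ≤ E₂ := integral_nonneg fun x => sq_nonneg _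
  set Ω : ℝ := C / (T - t₂) with hΩ
  have hΩ0 : 0 ≤ Ω := div_nonneg hC0 hTt₂.le
  -- the vorticity bound on the window
  have hωwin : ∀ t ∈ Icc t₁ t₂, ∀ x, ‖curl (u t) x‖ ≤ Ω := by
    intro t ht x
    have htI : t ∈ Ico t₀ T := ⟨h01.trans ht.1, lt_of_le_of_lt ht.2 h2T⟩
    have h := hω t htI x
    rw [hΩ, le_div_iff₀ hTt₂]
    calc ‖curl (u t) x‖ * (T - t₂) ≤ ‖curl (u t) x‖ * (T - t) :=
          mul_le_mul_of_nonneg_left (by linarith [ht.2]) (norm_nonneg _)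
      _ = (T - t) * ‖curl (u t) x‖ := mul_comm _ _
      _ ≤ C := h
  -- the backward slab bound: every slice of the window carries at least `m` of the final enstrophy
  set m : ℝ := E₂ * Real.exp (-(κ * Ω * (t₂ - t₁))) with hm
  have hm0 : 0 ≤ m := mul_nonneg hE₂0 (Real.exp_nonneg _)
  have hlow : ∀ t ∈ Ioo t₁ t₂, m ≤ ∫ x, ‖curl (u t) x‖ ^ 2 := by
    intro t ht
    have hEt0 : 0 ≤ ∫ x, ‖curl (u t) x‖ ^ 2 := integral_nonneg fun x => sq_nonneg _
    have hs := hslab (ht₁0.trans ht.1.le) ht.2 h2T (fun s hs x => hωwin s ⟨ht.1.le.trans hs.1, hs.2⟩ x)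
    -- `E₂ ≤ E(t) exp(κΩ(t₂ − t)) ≤ E(t) exp(κΩ(t₂ − t₁))`
    have hexp : Real.exp (κ * Ω * (t₂ - t)) ≤ Real.exp (κ * Ω * (t₂ - t₁)) :=
      Real.exp_le_exp.2 (mul_le_mul_of_nonneg_left (by linarith [ht.1]) (mul_nonneg hκ hΩ0))
    have h1 : E₂ ≤ (∫ x, ‖curl (u t) x‖ ^ 2) * Real.exp (κ * Ω * (t₂ - t₁)) :=
      hs.trans (mul_le_mul_of_nonneg_left hexp hEt0)
    rw [hm, Real.exp_neg]
    rw [← div_eq_mul_inv, div_le_iff₀ (Real.exp_pos _)]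
    exact h1
  -- integrate over the window against the budget
  have hint : ENNReal.ofReal m * ENNReal.ofReal (t₂ - t₁) ≤
      ENNReal.ofReal (VectorCalculus.kineticEnergy (u 0) / ν) := by
    calc ENNReal.ofReal m * ENNReal.ofReal (t₂ - t₁)
        = ∫⁻ _ in Ioo t₁ t₂, ENNReal.ofReal m := by rw [setLIntegral_const, Real.volume_Ioo]
      _ ≤ ∫⁻ t in Ioo t₁ t₂, ENNReal.ofReal (∫ x, ‖curl (u t) x‖ ^ 2) :=
          setLIntegral_mono' measurableSet_Ioo fun t ht => ENNReal.ofReal_le_ofReal (hlow t ht)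
      _ ≤ ENNReal.ofReal (VectorCalculus.kineticEnergy (u 0) / ν) :=
          lintegral_Ioo_enstrophy_le hν hT hcl hLH hdec ht₁0 h2T.le
  have hK0 : 0 ≤ VectorCalculus.kineticEnergy (u 0) / ν := div_nonneg (kineticEnergy_nonneg _) hν.le
  rw [← ENNReal.ofReal_mul hm0, ENNReal.ofReal_le_ofReal_iff hK0] at hint
  -- undo the exponential
  have hd : 0 < t₂ - t₁ := sub_pos.2 h12
  have hexp_eq : Real.exp (κ * C * (t₂ - t₁) / (T - t₂)) = Real.exp (κ * Ω * (t₂ - t₁)) := by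
    rw [hΩ]; congr 1; field_simp
  rw [hexp_eq]
  calc (t₂ - t₁) * E₂ = m * (t₂ - t₁) * Real.exp (κ * Ω * (t₂ - t₁)) := by
        rw [hm, Real.exp_neg]; field_simp
    _ ≤ VectorCalculus.kineticEnergy (u 0) / ν * Real.exp (κ * Ω * (t₂ - t₁)) :=
        mul_le_mul_of_nonneg_right hint (Real.exp_nonneg _)

/-- **TYPE-I ENSTROPHY UNDER THE CERTIFICATE.** In the setting of the window inequality with `κ > 0`, `C > 0`: for every
`t ∈ [t₀, T)` with `(T − t)/(κC) ≤ t − t₀` (the optimal window `[t − (T − t)/(κC), t]` fits inside `[t₀, T)`),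
`(T − t) ∫|curl u(t)|² ≤ e · κ · C · E(u₀)/ν` — the window inequality with `t₂ = t`, `t₂ − t₁ = (T − t)/(κC)`, whose
exponential factor is exactly `e`. [new here — elementary] -/
theorem mul_integral_sq_norm_curl_le_of_slab (hν : 0 < ν) (hT : 0 < T)
    (hcl : IsClassicalNSSolutionOn (Ico 0 T) ν 0 u p) (hLH : IsLerayHopfOn T ν 0 (u 0) u)
    (hdec : HasRapidSpatialDecay (u 0)) {κ : ℝ} (hκ : 0 < κ)
    (hslab : ∀ ⦃t₁ t₂ Ω : ℝ⦄, 0 ≤ t₁ → t₁ < t₂ → t₂ < T → (∀ t ∈ Icc t₁ t₂, ∀ x, ‖curl (u t) x‖ ≤ Ω) →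
      ∫ x, ‖curl (u t₂) x‖ ^ 2 ≤ (∫ x, ‖curl (u t₁) x‖ ^ 2) * Real.exp (κ * Ω * (t₂ - t₁)))
    {C t₀ : ℝ} (hC : 0 < C) (ht₀ : 0 ≤ t₀) (hω : ∀ t ∈ Ico t₀ T, ∀ x, (T - t) * ‖curl (u t) x‖ ≤ C)
    {t : ℝ} (ht : t ∈ Ico t₀ T) (hlate : (T - t) / (κ * C) ≤ t - t₀) :
    (T - t) * ∫ x, ‖curl (u t) x‖ ^ 2 ≤ Real.exp 1 * κ * C * VectorCalculus.kineticEnergy (u 0) / ν := by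
  have hTt : 0 < T - t := sub_pos.2 ht.2
  have hκC : 0 < κ * C := mul_pos hκ hC
  set θ : ℝ := (T - t) / (κ * C) with hθ
  have hθ0 : 0 < θ := div_pos hTt hκC
  have hwin := window_mul_integral_sq_norm_curl_le_of_slab hν hT hcl hLH hdec hκ.le hslab ht₀ hω
    (t₁ := t - θ) (t₂ := t) (by linarith) (by linarith) ht.2
  have hone : κ * C * θ / (T - t) = 1 := by
    rw [hθ]; field_simp
  rw [sub_sub_cancel, hone] at hwin
  -- `θ E(t) ≤ (E₀/ν) e`; multiply by `κC`
  have h := mul_le_mul_of_nonneg_left hwin hκC.le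
  calc (T - t) * ∫ x, ‖curl (u t) x‖ ^ 2 = κ * C * (θ * ∫ x, ‖curl (u t) x‖ ^ 2) := by
        rw [hθ]; field_simp
    _ ≤ κ * C * (VectorCalculus.kineticEnergy (u 0) / ν * Real.exp 1) := h
    _ = Real.exp 1 * κ * C * VectorCalculus.kineticEnergy (u 0) / ν := by ring

/-! ### The velocity cap and its gauge form -/

/-- **VELOCITY CAP UNDER THE CERTIFICATE: `(T − t)² ‖u(t, x)‖³ ≤ 8(4π)⁻¹ e κ C² E(u₀)/ν`** at every time of the Type-I
enstrophy cap and every `x`: slice Biot–Savart with `Ω = C/(T − t)` gives `(T − t)²‖u(t, x)‖³ ≤ 8(4π)⁻¹ C (T − t)∫|ω(t)|²`.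
So `‖u(t)‖_∞ ≲ (T − t)^{−2/3}`: the velocity rate exponent of the certificate class is at most `2/3`, for every `C`.
[cite: MajdaBertozziCUP2002, §4.1.3 (4.30)] -/
theorem sq_mul_cube_norm_le_of_slab (hν : 0 < ν) (hT : 0 < T)
    (hcl : IsClassicalNSSolutionOn (Ico 0 T) ν 0 u p) (hLH : IsLerayHopfOn T ν 0 (u 0) u)
    (hdec : HasRapidSpatialDecay (u 0)) {κ : ℝ} (hκ : 0 < κ)
    (hslab : ∀ ⦃t₁ t₂ Ω : ℝ⦄, 0 ≤ t₁ → t₁ < t₂ → t₂ < T → (∀ t ∈ Icc t₁ t₂, ∀ x, ‖curl (u t) x‖ ≤ Ω) →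
      ∫ x, ‖curl (u t₂) x‖ ^ 2 ≤ (∫ x, ‖curl (u t₁) x‖ ^ 2) * Real.exp (κ * Ω * (t₂ - t₁)))
    {C t₀ : ℝ} (hC : 0 < C) (ht₀ : 0 ≤ t₀) (hω : ∀ t ∈ Ico t₀ T, ∀ x, (T - t) * ‖curl (u t) x‖ ≤ C)
    {t : ℝ} (ht : t ∈ Ico t₀ T) (hlate : (T - t) / (κ * C) ≤ t - t₀) (x : EuclideanSpace ℝ (Fin 3)) :
    (T - t) ^ 2 * ‖u t x‖ ^ 3 ≤
      8 * (4 * Real.pi)⁻¹ * (Real.exp 1 * κ * C ^ 2 * VectorCalculus.kineticEnergy (u 0) / ν) := by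
  have hreg := hasBoundedSobolevNormsOn_before_of_lerayHopf_classical hν hT hcl hLH hdec
  have hTt : 0 < T - t := sub_pos.2 ht.2
  have htT : t ∈ Ico 0 T := ⟨ht₀.trans ht.1, ht.2⟩
  have hΩ : ∀ y, ‖curl (u t) y‖ ≤ C / (T - t) := fun y => by
    rw [le_div_iff₀ hTt, mul_comm]; exact hω t ht y
  have hcube := cube_norm_le_of_norm_curl_le hcl hreg htT hΩ x
  have hens := mul_integral_sq_norm_curl_le_of_slab hν hT hcl hLH hdec hκ hslab hC ht₀ hω ht hlate
  have hpi : 0 ≤ 8 * (4 * Real.pi)⁻¹ * C := by positivity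
  calc (T - t) ^ 2 * ‖u t x‖ ^ 3 ≤ (T - t) ^ 2 * (8 * (4 * Real.pi)⁻¹ * (C / (T - t)) * ∫ y, ‖curl (u t) y‖ ^ 2) :=
        mul_le_mul_of_nonneg_left hcube (sq_nonneg _)
    _ = 8 * (4 * Real.pi)⁻¹ * C * ((T - t) * ∫ y, ‖curl (u t) y‖ ^ 2) := by
        field_simp
    _ ≤ 8 * (4 * Real.pi)⁻¹ * C * (Real.exp 1 * κ * C * VectorCalculus.kineticEnergy (u 0) / ν) :=
        mul_le_mul_of_nonneg_left hens hpi
    _ = 8 * (4 * Real.pi)⁻¹ * (Real.exp 1 * κ * C ^ 2 * VectorCalculus.kineticEnergy (u 0) / ν) := by ring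

/-- **GAUGE FORM: `dₖ ≲ (T − tₖ)^{−1/3}` along every near-max gauge sequence.** At a time `tₖ` of the velocity cap with a
scale `λₖ > 0` and a point `xₖ` where `(λₖ/ν)‖u(tₖ, xₖ)‖ ≥ 1/2`, the dimensionless vertex distance `dₖ = ν(T − tₖ)/λₖ²`
satisfies `(T − tₖ) dₖ³ ≤ (64/ν³) B²`, `B = 8(4π)⁻¹ e κ C² E(u₀)/ν` (`dₖ ≤ 4(T − tₖ)‖u(tₖ, xₖ)‖²/ν`, cubed, and the velocity
cap squared). Deposit 7's KNSS Type-II gauge sequence has `dₖ → ∞`; this is the a priori bound on how fast.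
[cite: KochNadirashviliSereginSverak2009, Thms 6.1–6.2] -/
theorem mul_gauge_vertex_distance_cube_le_of_slab (hν : 0 < ν) (hT : 0 < T)
    (hcl : IsClassicalNSSolutionOn (Ico 0 T) ν 0 u p) (hLH : IsLerayHopfOn T ν 0 (u 0) u)
    (hdec : HasRapidSpatialDecay (u 0)) {κ : ℝ} (hκ : 0 < κ)
    (hslab : ∀ ⦃t₁ t₂ Ω : ℝ⦄, 0 ≤ t₁ → t₁ < t₂ → t₂ < T → (∀ t ∈ Icc t₁ t₂, ∀ x, ‖curl (u t) x‖ ≤ Ω) →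
      ∫ x, ‖curl (u t₂) x‖ ^ 2 ≤ (∫ x, ‖curl (u t₁) x‖ ^ 2) * Real.exp (κ * Ω * (t₂ - t₁)))
    {C t₀ : ℝ} (hC : 0 < C) (ht₀ : 0 ≤ t₀) (hω : ∀ t ∈ Ico t₀ T, ∀ x, (T - t) * ‖curl (u t) x‖ ≤ C)
    {tk lam : ℝ} (htk : tk ∈ Ico t₀ T) (hlate : (T - tk) / (κ * C) ≤ tk - t₀) (hlam : 0 < lam)
    {xk : EuclideanSpace ℝ (Fin 3)} (hnear : 1 / 2 ≤ lam / ν * ‖u tk xk‖) :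
    (T - tk) * (ν * (T - tk) / lam ^ 2) ^ 3 ≤
      64 / ν ^ 3 * (8 * (4 * Real.pi)⁻¹ * (Real.exp 1 * κ * C ^ 2 * VectorCalculus.kineticEnergy (u 0) / ν)) ^ 2 := by
  set B : ℝ := 8 * (4 * Real.pi)⁻¹ * (Real.exp 1 * κ * C ^ 2 * VectorCalculus.kineticEnergy (u 0) / ν) with hB
  have hTt : 0 < T - tk := sub_pos.2 htk.2
  have hcap := sq_mul_cube_norm_le_of_slab hν hT hcl hLH hdec hκ hslab hC ht₀ hω htk hlate xk
  rw [← hB] at hcap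
  set U : ℝ := ‖u tk xk‖ with hU
  have hU0 : 0 ≤ U := norm_nonneg _
  -- `ν/λ ≤ 2U`, hence `d ≤ 4(T − tₖ)U²/ν`
  have hνlam : ν / lam ≤ 2 * U := by
    rw [div_le_iff₀ hlam]
    have h := hnear
    rw [div_mul_eq_mul_div, le_div_iff₀ hν] at h
    linarith
  have hd' : ν * (T - tk) / lam ^ 2 ≤ 4 * (T - tk) * U ^ 2 / ν := by
    have h1 : ν * (T - tk) / lam ^ 2 = (T - tk) * (ν / lam) ^ 2 / ν := by
      field_simp
    rw [h1]
    refine div_le_div_of_nonneg_right ?_ hν.le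
    have h2 : (ν / lam) ^ 2 ≤ (2 * U) ^ 2 := pow_le_pow_left₀ (div_nonneg hν.le hlam.le) hνlam 2
    nlinarith [h2, hTt.le]
  have hd0 : 0 ≤ ν * (T - tk) / lam ^ 2 := by positivity
  -- cube, and insert the velocity cap squared
  have hU6 : ((T - tk) ^ 2) ^ 2 * U ^ 6 ≤ B ^ 2 := by
    have h := pow_le_pow_left₀ (by positivity) hcap 2
    calc ((T - tk) ^ 2) ^ 2 * U ^ 6 = ((T - tk) ^ 2 * U ^ 3) ^ 2 := by ring
      _ ≤ B ^ 2 := h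
  calc (T - tk) * (ν * (T - tk) / lam ^ 2) ^ 3 ≤ (T - tk) * (4 * (T - tk) * U ^ 2 / ν) ^ 3 :=
        mul_le_mul_of_nonneg_left (pow_le_pow_left₀ hd0 hd' 3) hTt.le
    _ = 64 / ν ^ 3 * (((T - tk) ^ 2) ^ 2 * U ^ 6) := by
        field_simp
        ring
    _ ≤ 64 / ν ^ 3 * B ^ 2 := by gcongr

end Summit.NavierStokesRegularity.NavierStokesRegularity.Theorems.CertifiedBlowupVorticityRateBlowup.DissipationBudget

end
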